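import Mathlib
import HarnessLib
import Literature.NumberTheory.Transcendental.SemialgebraicLineDeriv
import Literature.NumberTheory.Transcendental.SemialgebraicGrounding
import Literature.NumberTheory.Transcendental.SemialgebraicMapsProofs
import Literature.NumberTheory.Transcendental.KZSemialgebraicComplex
import Literature.NumberTheory.Transcendental.KZUnfoldedStokesProofs
import Literature.NumberTheory.Transcendental.KZLogCalculusProofs

/-!
# Stub `stub_bvStokes` of line `tame-bv-stokes` (crux `DihedralNormalForm`)

TAME BOUNDED VARIATION on the open unit cube: a `ℚ`-semialgebraic function `h` on the open cube
`(0,1)^{k+1}`, bounded by `C` and (Fréchet) differentiable at every point of the open cube, has an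
absolutely integrable `i`-th partial derivative `x ↦ fderiv ℝ h x (Pi.single i 1)` on the open
cube.

Proof (o-minimal bounded variation, fibrewise in the coordinate `i`):
* the partial derivative `D = ∂ᵢh` is `ℚ`-semialgebraic on the cube
  (`IsSemialgebraicFunOn.fderiv_apply_single`), hence a.e. strongly measurable there;
* the positivity set `{x ∈ cube | 0 < D x}`, read with the coordinate `i` moved last, is a
  `ℚ`-semialgebraic subset of `ℝ^{k+1}`, so membership of its last-coordinate fibres is locally
  constant off at most `B` points, `B` uniform in the base point
  (`FibreLength.exists_card_le_locallyConst`);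
* over a base point `β` of the open `k`-cube the fibre function `g u = h (insertNth i u β)` is
  differentiable on `(0,1)` with `g' u = D (insertNth i u β)` and `|g| ≤ C`; on each of the
  `≤ B + 1` complementary intervals of the switching points (inside `(0,1)`) the sign of `g'` is
  constant, so `g` is monotone there and `∫ |g'| = vol (g '' J) ≤ 2C`
  (`lintegral_deriv_eq_volume_image_of_monotoneOn`); hence `∫₀¹ |g'| ≤ 2C (B + 1)` uniformly;
* Tonelli along the coordinate `i` (`MeasurableEquiv.piFinSuccAbove`, `lintegral_prod_le`).
-/

noncomputable section

open MeasureTheory Set Filter Topology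
open scoped ENNReal

namespace Summit.KontsevichZagierPeriods.DihedralNormalForm.TameBVStokes

open Literature.NumberTheory.Transcendental Literature.ModelTheory.ExponentialFields

/-- On an order-connected set `J ⊆ ℝ`, a function `g` with derivative `g' ≥ 0` on `J` and
`|g| ≤ C` on `J` has `∫_J |g'| ≤ 2C` (it is monotone, and `∫_J g' = vol (g '' J)`). -/
private theorem lintegral_enorm_le_of_deriv_nonneg {J : Set ℝ} (hJ : J.OrdConnected)
    {g g' : ℝ → ℝ} {C : ℝ} (hderiv : ∀ t ∈ J, HasDerivAt g (g' t) t)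
    (hsign : ∀ t ∈ J, 0 ≤ g' t) (hbound : ∀ t ∈ J, |g t| ≤ C) :
    ∫⁻ t in J, ‖g' t‖ₑ ≤ ENNReal.ofReal (2 * C) := by
  have hmeas : MeasurableSet J := hJ.measurableSet
  have hmono : MonotoneOn g J := by
    refine monotoneOn_of_deriv_nonneg hJ.convex
      (fun t ht => (hderiv t ht).continuousAt.continuousWithinAt)
      (fun t ht => (hderiv t (interior_subset ht)).differentiableAt.differentiableWithinAt)
      fun t ht => ?_
    rw [(hderiv t (interior_subset ht)).deriv]
    exact hsign t (interior_subset ht)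
  calc ∫⁻ t in J, ‖g' t‖ₑ = ∫⁻ t in J, ENNReal.ofReal (g' t) :=
        setLIntegral_congr_fun hmeas fun t ht => by rw [Real.enorm_eq_ofReal (hsign t ht)]
    _ = volume (g '' J) := lintegral_deriv_eq_volume_image_of_monotoneOn hmeas
        (fun t ht => (hderiv t ht).hasDerivWithinAt) hmono
    _ ≤ volume (Icc (-C) C) := by
        refine measure_mono ?_
        rintro _ ⟨t, ht, rfl⟩
        exact abs_le.1 (hbound t ht)
    _ = ENNReal.ofReal (2 * C) := by
        rw [Real.volume_Icc]
        congr 1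
        ring

/-- The same bound when the sign of `g'` on `J` is constant but unknown: `g' ≥ 0` on `J` or
`g' ≤ 0` on `J`. -/
private theorem lintegral_enorm_le_of_deriv_sign {J : Set ℝ} (hJ : J.OrdConnected)
    {g g' : ℝ → ℝ} {C : ℝ} (hderiv : ∀ t ∈ J, HasDerivAt g (g' t) t)
    (hsign : (∀ t ∈ J, 0 ≤ g' t) ∨ (∀ t ∈ J, g' t ≤ 0)) (hbound : ∀ t ∈ J, |g t| ≤ C) :
    ∫⁻ t in J, ‖g' t‖ₑ ≤ ENNReal.ofReal (2 * C) := by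
  rcases hsign with hsign | hsign
  · exact lintegral_enorm_le_of_deriv_nonneg hJ hderiv hsign hbound
  · have h := lintegral_enorm_le_of_deriv_nonneg hJ (g := fun t => -g t) (g' := fun t => -g' t)
      (C := C) (fun t ht => (hderiv t ht).neg) (fun t ht => neg_nonneg.2 (hsign t ht))
      (fun t ht => by rw [abs_neg]; exact hbound t ht)
    simpa only [enorm_neg] using h

/-- **Uniform fibre bound.** If `g` is differentiable on `(0,1)` with derivative `g'`, `|g| ≤ C`
there, and membership in `{u ∈ (0,1) | 0 < g' u}` is locally constant off the finite set `R`,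
then `∫_{(0,1)} |g'| ≤ 2C (#R + 1)`: on each complementary interval of `R` inside `(0,1)` the
sign of `g'` is constant (connectedness). -/
private theorem lintegral_enorm_deriv_le_card {g g' : ℝ → ℝ} {C : ℝ} (R : Finset ℝ)
    (hderiv : ∀ t ∈ Ioo (0 : ℝ) 1, HasDerivAt g (g' t) t)
    (hbound : ∀ t ∈ Ioo (0 : ℝ) 1, |g t| ≤ C)
    (hloc : ∀ u ∉ (R : Set ℝ), ∀ᶠ u' in 𝓝 u,
      u' ∈ {v | v ∈ Ioo (0 : ℝ) 1 ∧ 0 < g' v} ↔ u ∈ {v | v ∈ Ioo (0 : ℝ) 1 ∧ 0 < g' v}) :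
    ∫⁻ t in Ioo (0 : ℝ) 1, ‖g' t‖ₑ ≤ ((R.card : ℝ≥0∞) + 1) * ENNReal.ofReal (2 * C) := by
  set P : Set ℝ := {v | v ∈ Ioo (0 : ℝ) 1 ∧ 0 < g' v} with hP
  set J : Fin (R.card + 1) → Set ℝ := fun j => FibreLength.gap R j ∩ Ioo (0 : ℝ) 1 with hJ
  have hcover : Ioo (0 : ℝ) 1 ⊆ (R : Set ℝ) ∪ ⋃ j, J j := by
    intro u hu
    by_cases huR : u ∈ (R : Set ℝ)
    · exact Or.inl huR
    · obtain ⟨j, hj⟩ := FibreLength.exists_mem_gap huR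
      exact Or.inr (mem_iUnion.2 ⟨j, hj, hu⟩)
  have hpiece : ∀ j, ∫⁻ t in J j, ‖g' t‖ₑ ≤ ENNReal.ofReal (2 * C) := by
    intro j
    have hJoc : (J j).OrdConnected := (FibreLength.ordConnected_gap j).inter ordConnected_Ioo
    have hloc' : ∀ u ∈ J j, ∀ᶠ u' in 𝓝 u, u' ∈ P ↔ u ∈ P := fun u hu =>
      hloc u (FibreLength.not_mem_of_mem_gap hu.1)
    refine lintegral_enorm_le_of_deriv_sign hJoc (fun t ht => hderiv t ht.2) ?_
      fun t ht => hbound t ht.2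
    rcases FibreLength.subset_or_disjoint_of_isPreconnected hJoc.isPreconnected hloc' with h | h
    · exact Or.inl fun t ht => (h ht).2.le
    · exact Or.inr fun t ht => not_lt.1 fun h' => Set.disjoint_left.1 h ht ⟨ht.2, h'⟩
  have hRnull : ∫⁻ t in (R : Set ℝ), ‖g' t‖ₑ = 0 :=
    setLIntegral_measure_zero _ _ (R.finite_toSet.measure_zero _)
  calc ∫⁻ t in Ioo (0 : ℝ) 1, ‖g' t‖ₑ ≤ ∫⁻ t in (R : Set ℝ) ∪ ⋃ j, J j, ‖g' t‖ₑ :=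
        lintegral_mono_set hcover
    _ ≤ (∫⁻ t in (R : Set ℝ), ‖g' t‖ₑ) + ∫⁻ t in ⋃ j, J j, ‖g' t‖ₑ := lintegral_union_le _ _ _
    _ ≤ 0 + ∑ j, ∫⁻ t in J j, ‖g' t‖ₑ := by
        rw [hRnull]
        refine add_le_add le_rfl ?_
        have := lintegral_iUnion_le J (fun t => ‖g' t‖ₑ) (μ := volume)
        rwa [tsum_fintype] at this
    _ ≤ 0 + ∑ _j : Fin (R.card + 1), ENNReal.ofReal (2 * C) :=
        add_le_add le_rfl (Finset.sum_le_sum fun j _ => hpiece j)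
    _ = ((R.card : ℝ≥0∞) + 1) * ENNReal.ofReal (2 * C) := by
        rw [zero_add, Finset.sum_const, Finset.card_univ, Fintype.card_fin, nsmul_eq_mul]
        push_cast
        ring

/-- Relabelling the coordinates so that the LAST coordinate is inserted at slot `i`:
`z ∘ ρ = insertNth i (z last) (init z)` for the map `ρ = insertNth i last castSucc`. -/
private theorem comp_insertNth_last_castSucc {k : ℕ} (i : Fin (k + 1)) (z : Fin (k + 1) → ℝ) :
    (z ∘ fun l =>
        (i.insertNth (Fin.last k) (fun j => Fin.castSucc j) : Fin (k + 1) → Fin (k + 1)) l) =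
      i.insertNth (z (Fin.last k)) (Fin.init z) := by
  ext l
  refine Fin.succAboveCases i ?_ (fun j => ?_) l
  · simp only [Function.comp_apply, Fin.insertNth_apply_same]
  · simp only [Function.comp_apply, Fin.insertNth_apply_succAbove, Fin.init]

/-- **Uniform fibre bound for a bounded semialgebraic function on the open cube.** For `h`
`ℚ`-semialgebraic on the open cube `(0,1)^{k+1}`, `|h| ≤ C`, differentiable at every point of the
open cube, there is `B` with `∫₀¹ |∂ᵢh (insertNth i t β)| dt ≤ 2C (B + 1)` for every `β` in the
open `k`-cube. -/
private theorem exists_fibre_bound {k : ℕ} (i : Fin (k + 1)) {h : (Fin (k + 1) → ℝ) → ℝ} {C : ℝ}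
    (hh : IsSemialgebraicFunOn ℚ (KZ.unitCube (k + 1)) h)
    (hC : ∀ x ∈ KZ.unitCube (k + 1), |h x| ≤ C)
    (hdiff : ∀ x ∈ KZ.unitCube (k + 1), DifferentiableAt ℝ h x) :
    ∃ B : ℕ, ∀ β ∈ KZ.unitCube k,
      ∫⁻ t in Ioo (0 : ℝ) 1, ‖fderiv ℝ h (i.insertNth t β) (Pi.single i 1)‖ₑ ≤
        ((B : ℝ≥0∞) + 1) * ENNReal.ofReal (2 * C) := by
  set D : (Fin (k + 1) → ℝ) → ℝ := fun x => fderiv ℝ h x (Pi.single i 1)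
  have hD : IsSemialgebraicFunOn ℚ (KZ.unitCube (k + 1)) D :=
    hh.fderiv_apply_single (KZ.isOpen_unitCube _) hdiff i
  -- the positivity set of `D`, and its transport moving the coordinate `i` last
  set P : Set (Fin (k + 1) → ℝ) := {x | x ∈ KZ.unitCube (k + 1) ∧ 0 < D x} with hP_def
  have hP : IsSemialgebraic ℚ P := by
    convert hD.neg.isSemialgebraic_sep_neg using 1
    ext x
    simp only [hP_def, mem_setOf_eq, Pi.neg_apply, neg_lt_zero]
  set ρ : Fin (k + 1) → Fin (k + 1) := fun l =>
    (i.insertNth (Fin.last k) (fun j => Fin.castSucc j) : Fin (k + 1) → Fin (k + 1)) l with hρ_def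
  have hcomp : ∀ (β : Fin k → ℝ) (u : ℝ),
      ((Fin.snoc β u : Fin (k + 1) → ℝ) ∘ ρ) = i.insertNth u β := by
    intro β u
    rw [hρ_def, comp_insertNth_last_castSucc, Fin.snoc_last, Fin.init_snoc]
  set P' : Set (Fin (k + 1) → ℝ) := (fun z : Fin (k + 1) → ℝ => z ∘ ρ) ⁻¹' P with hP'_def
  have hP' : IsSemialgebraic ℚ P' := hP.preimage_comp ρ
  obtain ⟨B, hB⟩ := FibreLength.exists_card_le_locallyConst hP'
  refine ⟨B, fun β hβ => ?_⟩
  obtain ⟨R, hRB, hloc⟩ := hB β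
  -- the fibre function and its derivative
  have hmemQ : ∀ u : ℝ, (i.insertNth u β : Fin (k + 1) → ℝ) ∈ KZ.unitCube (k + 1) ↔
      u ∈ Ioo (0 : ℝ) 1 := by
    intro u
    rw [KZ.mem_unitCube_succ_iff i, Fin.insertNth_apply_same, Fin.removeNth_insertNth]
    exact ⟨fun h => h.1, fun h => ⟨h, hβ⟩⟩
  have hmemP : ∀ u : ℝ, (Fin.snoc β u : Fin (k + 1) → ℝ) ∈ P' ↔
      u ∈ {v | v ∈ Ioo (0 : ℝ) 1 ∧ 0 < D (i.insertNth v β)} := by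
    intro u
    rw [hP'_def, mem_preimage, hcomp, hP_def, mem_setOf_eq, hmemQ]
    rfl
  have hloc' : ∀ u ∉ (R : Set ℝ), ∀ᶠ u' in 𝓝 u,
      u' ∈ {v | v ∈ Ioo (0 : ℝ) 1 ∧ 0 < D (i.insertNth v β)} ↔
        u ∈ {v | v ∈ Ioo (0 : ℝ) 1 ∧ 0 < D (i.insertNth v β)} := by
    intro u hu
    simpa only [hmemP] using hloc u hu
  have hderiv : ∀ t ∈ Ioo (0 : ℝ) 1,
      HasDerivAt (fun s => h (i.insertNth s β)) (D (i.insertNth t β)) t := by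
    intro t ht
    have hx : (i.insertNth t β : Fin (k + 1) → ℝ) ∈ KZ.unitCube (k + 1) := (hmemQ t).2 ht
    exact (hdiff _ hx).hasFDerivAt.comp_hasDerivAt t (KZ.hasDerivAt_insertNth i β t)
  have hbound : ∀ t ∈ Ioo (0 : ℝ) 1, |h (i.insertNth t β)| ≤ C := fun t ht =>
    hC _ ((hmemQ t).2 ht)
  have hfib := lintegral_enorm_deriv_le_card (g := fun s => h (i.insertNth s β))
    (g' := fun s => D (i.insertNth s β)) R hderiv hbound hloc'
  have hRB' : (R.card : ℝ≥0∞) + 1 ≤ (B : ℝ≥0∞) + 1 :=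
    add_le_add (by exact_mod_cast hRB) le_rfl
  exact hfib.trans (mul_le_mul' hRB' le_rfl)

/-- **stub_bvStokes** (tame bounded variation on the open cube). A `ℚ`-semialgebraic `h` on the
open cube `(0,1)^{k+1}`, bounded by `C` and differentiable at every point of the open cube, has
absolutely integrable `i`-th partial derivative `x ↦ fderiv ℝ h x (Pi.single i 1)` on the open
cube: fibrewise in the coordinate `i` the derivative changes sign at most `B` times, `B` uniform
(`exists_fibre_bound`), so `∫₀¹ |∂ᵢh| ≤ 2C (B + 1)` on every fibre; Tonelli along `i`. -/
theorem stub_bvStokes : ∀ (k : ℕ) (i : Fin (k + 1)) (h : (Fin (k + 1) → ℝ) → ℝ) (C : ℝ), Literature.NumberTheory.Transcendental.IsSemialgebraicFunOn ℚ {x : Fin (k + 1) → ℝ | ∀ i, x i ∈ Set.Ioo (0:ℝ) 1} h → (∀ x ∈ {x : Fin (k + 1) → ℝ | ∀ i, x i ∈ Set.Ioo (0:ℝ) 1}, |h x| ≤ C) → (∀ x ∈ {x : Fin (k + 1) → ℝ | ∀ i, x i ∈ Set.Ioo (0:ℝ) 1}, DifferentiableAt ℝ h x) → MeasureTheory.IntegrableOn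 (fun x => fderiv ℝ h x (Pi.single i 1)) {x : Fin (k + 1) → ℝ | ∀ i, x i ∈ Set.Ioo (0:ℝ) 1} := by
  intro k i h C hh hC hdiff
  change IntegrableOn (fun x => fderiv ℝ h x (Pi.single i 1)) (KZ.unitCube (k + 1))
  change IsSemialgebraicFunOn ℚ (KZ.unitCube (k + 1)) h at hh
  change ∀ x ∈ KZ.unitCube (k + 1), |h x| ≤ C at hC
  change ∀ x ∈ KZ.unitCube (k + 1), DifferentiableAt ℝ h x at hdiff
  set D : (Fin (k + 1) → ℝ) → ℝ := fun x => fderiv ℝ h x (Pi.single i 1)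
  have hD : IsSemialgebraicFunOn ℚ (KZ.unitCube (k + 1)) D :=
    hh.fderiv_apply_single (KZ.isOpen_unitCube _) hdiff i
  obtain ⟨B, hB⟩ := exists_fibre_bound i hh hC hdiff
  have hmeas : AEStronglyMeasurable D (volume.restrict (KZ.unitCube (k + 1))) :=
    KZ.aestronglyMeasurable_of_isSemialgebraicFunOn hD (KZ.isOpen_unitCube _).measurableSet
  refine ⟨hmeas, ?_⟩
  rw [hasFiniteIntegral_iff_enorm]
  -- Tonelli along the coordinate `i`
  set e := MeasurableEquiv.piFinSuccAbove (fun _ : Fin (k + 1) => ℝ) i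
  have he : MeasurePreserving e volume volume := volume_preserving_piFinSuccAbove (fun _ => ℝ) i
  have hpre : e ⁻¹' (Ioo (0 : ℝ) 1 ×ˢ KZ.unitCube k) = KZ.unitCube (k + 1) :=
    KZ.preimage_piFinSuccAbove_prod_unitCube i
  set F : (Fin (k + 1) → ℝ) → ℝ≥0∞ := fun x => ‖D x‖ₑ
  have h1 : ∫⁻ x in KZ.unitCube (k + 1), F x =
      ∫⁻ p in Ioo (0 : ℝ) 1 ×ˢ KZ.unitCube k, F (e.symm p) := by
    rw [← hpre]
    have : ∀ x, F x = (F ∘ e.symm) (e x) := fun x => by simp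
    calc ∫⁻ x in e ⁻¹' (Ioo (0 : ℝ) 1 ×ˢ KZ.unitCube k), F x
        = ∫⁻ x in e ⁻¹' (Ioo (0 : ℝ) 1 ×ˢ KZ.unitCube k), (F ∘ e.symm) (e x) :=
          lintegral_congr fun x => this x
      _ = ∫⁻ p in Ioo (0 : ℝ) 1 ×ˢ KZ.unitCube k, (F ∘ e.symm) p :=
          he.setLIntegral_comp_preimage_emb e.measurableEmbedding _ _
  have h2 : ∫⁻ p in Ioo (0 : ℝ) 1 ×ˢ KZ.unitCube k, F (e.symm p) =
      ∫⁻ p, F (e.symm p) ∂((volume.restrict (Ioo (0 : ℝ) 1)).prod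
        (volume.restrict (KZ.unitCube k))) := by
    rw [Measure.prod_restrict, ← Measure.volume_eq_prod]
  have h3 : ∫⁻ p, F (e.symm p) ∂((volume.restrict (Ioo (0 : ℝ) 1)).prod
        (volume.restrict (KZ.unitCube k))) ≤
      ∫⁻ y in KZ.unitCube k, ∫⁻ t in Ioo (0 : ℝ) 1, F (e.symm (t, y)) := by
    rw [← lintegral_prod_swap]
    exact lintegral_prod_le _
  have h4 : ∫⁻ y in KZ.unitCube k, ∫⁻ t in Ioo (0 : ℝ) 1, F (e.symm (t, y)) ≤
      ∫⁻ _ in KZ.unitCube k, ((B : ℝ≥0∞) + 1) * ENNReal.ofReal (2 * C) :=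
    setLIntegral_mono' (KZ.isOpen_unitCube _).measurableSet fun y hy => hB y hy
  have h5 : ∫⁻ _ in KZ.unitCube k, ((B : ℝ≥0∞) + 1) * ENNReal.ofReal (2 * C) < ∞ := by
    rw [setLIntegral_const]
    refine ENNReal.mul_lt_top (ENNReal.mul_lt_top (by simp) ENNReal.ofReal_lt_top) ?_
    exact (measure_mono (KZ.unitCube_subset_Icc k)).trans_lt isCompact_Icc.measure_lt_top
  calc ∫⁻ x in KZ.unitCube (k + 1), ‖D x‖ₑ = ∫⁻ x in KZ.unitCube (k + 1), F x := rfl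
    _ ≤ ∫⁻ _ in KZ.unitCube k, ((B : ℝ≥0∞) + 1) * ENNReal.ofReal (2 * C) := by
        rw [h1, h2]; exact h3.trans h4
    _ < ∞ := h5

end Summit.KontsevichZagierPeriods.DihedralNormalForm.TameBVStokes
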